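import Summits.QuantumFields.BalabanUV.Beta.EriceRemainderEnclosureHistoryRenewalContinuum
import Literature.MathematicalPhysics.QuantumFieldTheory.Balaban1983to89.T4BetaFlowWellPosed

/-!
# EriceRemainderEnclosureHistoryAutonomy — (E37a) THE AUTONOMY ROW OF THE HISTORY CHANNEL: the identification of the continuum
# flow with the memory flow of ONE functional — `bstar g m = betaInf β (limHist g m)`,
# `1∕g⋆_{m+1}² = 1∕g⋆_m² + betaInf β (g⋆_{m+1}, g⋆_{m+2}, …)` — needs NO memory hypothesis: NE4's scale-shift rate (for the limit
# functional to exist) and CONTINUITY of every `β_{k+1}` on its box suffice; node U2's `HistLipschitz Λ γ β` ∧ `FadingMemory Cm θs Λ`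
# in `T4BetaStationary.tendsto_betaInf_histAbove` ∕ `tendsto_beta_diag_betaInf` ∕ `bstar_eq_betaInf` ∕ `gstar_flow_autonomous` are IDLE,
# and the existence of the continuum coupling enters only as `invSq g m n → astar g m` — which (E33d) supplies WITHOUT `FadingMemory`

Cell `pub-balaban`, β-function sub-cell, BINDER row D4 «RemainderConst leaves for Bałaban's split» (`HOME/BINDER-OWNERS.md`; owner
lineage `b2b-balaban-beta-an4`; this file by co-owner #2 lineage `b2b-balaban-beta-d4-p2`, generation 39), β-FLOW TEAM duty (1),
FREEZE (0) honoured (def-free module in the lineage's `EriceRemainderEnclosure*` series; no new leaf, no new hypothesis shape).  Sequel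
of (E33d) `EriceRemainderEnclosureHistoryRenewalContinuum` (the continuum recursion variable `astar g m` EXISTS with a k-uniform ROW
total weight of the history modulus only — no decay in the age) over node U2's `T4BetaStationary` (lineage `b2b-balaban-t4-ne4-p1`,
gen 11: `betaInf`, `revHist`, `SeqBox`, `histAbove`, `limHist`, `abs_beta_revHist_sub_betaInf_le`, `revHist_histAbove` BY NAME),
`T4ContinuumCoupling` (lineage `b2b-balaban-t4-ne4-p2`: `invSq`, `astar`, `gstar`, `bstar`, `invSq_flow`, `invSq_zero`,
`one_div_sqrt_invSq`, `inv_sq_gamma_le_invSq`) and `T4BetaFlowWellPosed` (`MemFlow`, the `1∕√·` lemmas).  Companions: (E37b)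
`EriceRemainderEnclosureHistoryAutonomyWellPosed` (the memory flow is WELL-POSED under the ZEROTH age-moment of the functional alone:
`T4BetaFlowWellPosed` §§3–4 with `MemoryProfile Cm θ γ B` replaced by `|B u − B u′| ≤ M·sup_j |u j − u′ j|`, smallness `M·γ < b`), (E37c)
`EriceRemainderEnclosureHistoryAutonomyEnd` (rows `Σ_i Λ k i ≤ M` of `HistLipschitz` ARE that zeroth moment for `betaInf β`; under
(E33)'s rows-only class the continuum running coupling is characterised INTRINSICALLY by `(betaInf β, g_IR)` — node U2's
`T4BetaFlowWellPosed.eq_gstar_of_memFlow` with `FadingMemory` deleted).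

HONEST FRAMING (page 1, verbatim and binding).  *"Discharging BetaPertH makes Bałaban's UV stability UNCONDITIONAL — a real
constructive-QFT result; it is NOT the continuum limit and NOT the Clay problem."*  THIS FILE DISCHARGES NOTHING OF THE KIND.  It is
elementary real analysis (uniform limits of continuous functions are continuous; limits in `ℝ`) on node U2's typed HYPOTHESIS SHAPES
over an ABSTRACT family `β : FlowStep.HBeta` — `ScaleShiftRate c θ γ β` (NE4 for the full β; NOT PRINTED, GAPS G-t4-U2-1: «NO statement
on the k-dependence of β_{k+1} — no convergence β_{k+1} → β_∞, no rate»), `BetaContH γ β` ([I] p. 263–264 «C^∞-function of g_{j−1}»,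
said of the LAST variable; joint continuity is this tree's reading, GAPS G-adv2-3), the runs `RGEqH K β (g K)` in the box, and — in §3
only — `HistLipschitz Λ γ β` with rows `≤ M`, the sign ∕ floor and the smallness of (E33) (NOT PRINTED, GAPS G-t4-U2-2; [I] p. 298 says
only that the dependence on the preceding couplings exists).  NONE is asserted for [I] (1.22).  Nothing of Bałaban's is quoted newly:
the loci behind the shapes ((0.20) p. 256, p. 264, p. 298) are quoted verbatim in the headers of `FlowStep` and `T4CouplingMatching`.
Row D4 class UNCHANGED (critical-path width 0; instance 0∕1; D4 DISCHARGE NO DATE).  HONEST DEPENDENCY: continuum YM on T⁴ ⇐ BetaPertH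
∧ nine spine estimates (0/9 proved); BetaPertH ⇐ (D1) ∧ (D4) ∧ CAP+tail; G-an2-4 gates asym, D1 and NE2/3/4.

THE POINT (census sense (α); the history channel's AUTONOMY row — the cell between node U2's `T4BetaStationary` §5 and (E33d)).  Node
U2 identifies P2's continuum β-value `bstar g m` with ONE scale-independent functional `betaInf β` evaluated on the limit trajectory's own
ultraviolet history, `bstar_eq_betaInf` ∕ `gstar_flow_autonomous` — (0.20) in the continuum as an AUTONOMOUS flow with memory (the
question [BenfattoGallavotti1995] ch. 10 leaves open for its «beta functional», (10.33)–(10.35)) — from the binder list «node U2's output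
shape `InjectedRate C 0 θ`, `ScaleShiftRate c θs γ β`, `HistLipschitz Λ γ β`, `FadingMemory Cm θs Λ`»: the Tannery step
`betaInf β (histAbove g m n) → betaInf β (limHist g m)` is taken there through the geometric MEMORY PROFILE of `betaInf β`
(`memoryProfile_betaInf`, dominated convergence against `γθs^j`).  THIS FILE: the memory profile is NOT what that step consumes.  Under
`ScaleShiftRate` the prefix functionals `h ↦ β k (revHist h k)` converge to `betaInf β` UNIFORMLY on the box-valued histories
(`abs_beta_revHist_sub_betaInf_le`: `≤ cθ^k∕(1−θ)`), each is continuous in the PRODUCT topology as soon as `β k` is continuous on its box,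
so `betaInf β` is continuous in the product topology on `SeqBox γ` (§1 `continuousOn_betaInf`) and agewise convergence of box histories is
all the Tannery step needs (§1 `tendsto_betaInf_of_agewise`).  Hence (§2) for ANY family of runs in the box whose recursion variables
converge at every physical scale (`∀ m, invSq g m n → astar g m` — node U2's shape gives it with a geometric tail, (E33d) gives it from
a k-uniform ROW total weight WITHOUT any decay of the memory, and nothing else about HOW the limit is reached is used):
`β n (g (n+m+1))_{0..n} → betaInf β (limHist g m)`, `bstar g m = betaInf β (limHist g m)`, `1∕g⋆_{m+1}² = 1∕g⋆_m² + betaInf β (g⋆_{m+1+·})`,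
`MemFlow (betaInf β) g_IR (gstar g)`.  §3 ENDs: node U2's `gstar_flow_autonomous` with `FadingMemory Cm θs Λ` DELETED (and `HistLipschitz`
kept only as the source of continuity, any `Λ`); the same under (E33)'s rows-only sign ∕ eventual classes BY NAME from `continuum_of_sign` ∕
`continuum_of_eventual`.  So in the history channel's moment table the AUTONOMY row costs the history NOTHING beyond what EXISTENCE costs
(rows, (E33)); what the zeroth moment DOES buy at this row — that the memory flow DETERMINES the trajectory, i.e. the intrinsic
characterisation of the continuum running coupling by `(betaInf β, g_IR)` — is (E37b)∕(E37c).  What is NOT claimed: any rate for the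
identification (the tail of `invSq g m n − astar g m` is the RATE row, (E33)∕(E36)); anything for a family WITHOUT `ScaleShiftRate` (then
`betaInf` is a bare `limUnder`); anything about Bałaban's (1.22).  AS-PRINTED: Erice's THE CLAIM p. 249 «{β_n(g²)} … convergent to a function
β(g²)» (`BetaFlowAsPrinted.Conclusions.c369claim`, POINTWISE, no mode — DELTA D-11) is the Markov shadow of `tendsto_betaInf`; the
identification here consumes the UNIFORM convergence that `ScaleShiftRate` carries, not pointwise convergence alone.

WHAT IS PROVED ([folklore] real analysis over the tree's shapes; 0 `def`, 0 sorry; nothing of [I] asserted).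
 §1 `continuousOn_beta_revHist`, `tendstoUniformlyOn_beta_revHist`, **`continuousOn_betaInf`** (`ScaleShiftRate` + `BetaContH` ⟹ `betaInf β`
    continuous on `{h | SeqBox γ h}` in the product topology), **`tendsto_betaInf_of_agewise`** (sequential form), `…_of_histLipschitz`.
 §2 Under `hconv : ∀ m, Tendsto (invSq g m) atTop (𝓝 (astar g m))` for runs in the box: `inv_sq_gamma_le_astar_of_tendsto`, `astar_pos_of_tendsto`,
    `gstar_pos_of_tendsto`, `gstar_le_of_tendsto`, `one_div_gstar_sq_of_tendsto`, `tendsto_coupling_of_tendsto`, `astar_zero_of_tendsto`,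
    `gstar_zero_of_tendsto`, `seqBox_gstar_of_tendsto`, `limHist_seqBox_of_tendsto`, `tendsto_histAbove_of_tendsto`,
    **`tendsto_betaInf_histAbove_of_tendsto`**, **`tendsto_beta_diag_betaInf_of_tendsto`**, `tendsto_beta_diag_of_tendsto`,
    **`bstar_eq_betaInf_of_tendsto`**, `gstar_flow_of_tendsto`, **`gstar_flow_autonomous_of_tendsto`**, **`memFlow_gstar_of_tendsto`**.
 §3 ENDs: **`gstar_flow_autonomous_of_injectedRate`** ∕ `bstar_eq_betaInf_of_injectedRate` ∕ `memFlow_gstar_of_injectedRate` (node U2's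
    binder list with `FadingMemory` deleted), **`memFlow_gstar_of_sign`**, **`memFlow_gstar_of_eventual`** ((E33)'s rows-only classes).
-/

noncomputable section
open Filter Topology Finset

namespace Summit.QuantumFields.BalabanUV.Beta.EriceRemainderEnclosureHistoryAutonomy

open Literature.MathematicalPhysics.QuantumFieldTheory.Balaban1983to89
open Literature.MathematicalPhysics.QuantumFieldTheory.Balaban1983to89.FlowStep
open Literature.MathematicalPhysics.QuantumFieldTheory.Balaban1983to89.T4CouplingMatching
open Literature.MathematicalPhysics.QuantumFieldTheory.Balaban1983to89.T4CauchySum (InjectedRate)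
open Literature.MathematicalPhysics.QuantumFieldTheory.Balaban1983to89.T4ContinuumCoupling
open Literature.MathematicalPhysics.QuantumFieldTheory.Balaban1983to89.T4BetaStationary
open Literature.MathematicalPhysics.QuantumFieldTheory.Balaban1983to89.T4BetaFlowWellPosed
  (MemFlow one_div_sqrt_le one_div_sq_one_div_sqrt one_div_sqrt_one_div_sq)
open Summit.QuantumFields.BalabanUV.Beta.EriceRemainderEnclosureHistoryRenewalContinuum
  (continuum_of_sign continuum_of_eventual)

variable {β : HBeta} {γ c θ : ℝ}

/-! ## §1 The limit functional is continuous in the product topology — no memory hypothesis -/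

/-- Each PREFIX FUNCTIONAL `h ↦ β k (revHist h k)` is continuous on the box-valued reversed histories in the PRODUCT topology of
`ℕ → ℝ`, as soon as `β k` is continuous on its box (`BetaContH γ β`): it factors through the finitely many coordinates `h 0, …, h k`.
[folklore] -/
theorem continuousOn_beta_revHist (hcont : BetaContH γ β) (k : ℕ) :
    ContinuousOn (fun h : ℕ → ℝ => β k (revHist h k)) {h | SeqBox γ h} := by
  have hrev : Continuous (fun h : ℕ → ℝ => revHist h k) := by
    refine continuous_pi fun i => ?_
    simp only [revHist]
    exact continuous_apply _
  exact (hcont k).comp hrev.continuousOn fun h hh => revHist_mem_box hh k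

/-- Under `ScaleShiftRate c θ γ β` (`0 ≤ θ < 1`) the prefix functionals converge to `betaInf β` UNIFORMLY on the box-valued histories
(node U2's representation tail `|β k (revHist h k) − betaInf β h| ≤ cθ^k∕(1−θ)`, uniform in `h`). [folklore] -/
theorem tendstoUniformlyOn_beta_revHist (hss : ScaleShiftRate c θ γ β) (hθ0 : 0 ≤ θ) (hθ1 : θ < 1) :
    TendstoUniformlyOn (fun k (h : ℕ → ℝ) => β k (revHist h k)) (betaInf β) atTop {h | SeqBox γ h} := by
  rw [Metric.tendstoUniformlyOn_iff]
  intro ε hε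
  have ht : Tendsto (fun k : ℕ => c * θ ^ k / (1 - θ)) atTop (𝓝 (c * 0 / (1 - θ))) :=
    ((tendsto_pow_atTop_nhds_zero_of_lt_one hθ0 hθ1).const_mul c).div_const (1 - θ)
  rw [mul_zero, zero_div] at ht
  filter_upwards [(tendsto_order.1 ht).2 ε hε] with k hk h hh
  rw [Real.dist_eq, abs_sub_comm]
  exact (abs_beta_revHist_sub_betaInf_le hss hθ1 hh k).trans_lt hk

/-- **THE LIMIT FUNCTIONAL IS CONTINUOUS IN THE PRODUCT TOPOLOGY on the box-valued histories** — from `ScaleShiftRate` (uniform limit) and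
`BetaContH` (each prefix functional continuous) alone: a uniform limit of continuous functions is continuous.  NO history modulus, NO
fading memory. [folklore] -/
theorem continuousOn_betaInf (hss : ScaleShiftRate c θ γ β) (hθ0 : 0 ≤ θ) (hθ1 : θ < 1) (hcont : BetaContH γ β) :
    ContinuousOn (betaInf β) {h | SeqBox γ h} :=
  (tendstoUniformlyOn_beta_revHist hss hθ0 hθ1).continuousOn
    (Eventually.of_forall fun k => continuousOn_beta_revHist hcont k).frequently

/-- **SEQUENTIAL FORM (the Tannery step without a memory profile)**: box-valued histories `H n` converging AGEWISE to a box-valued history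
`h` have `betaInf β (H n) → betaInf β h`. [folklore] -/
theorem tendsto_betaInf_of_agewise (hss : ScaleShiftRate c θ γ β) (hθ0 : 0 ≤ θ) (hθ1 : θ < 1) (hcont : BetaContH γ β)
    {H : ℕ → ℕ → ℝ} {h : ℕ → ℝ} (hH : ∀ n, SeqBox γ (H n)) (hh : SeqBox γ h)
    (hconv : ∀ j, Tendsto (fun n => H n j) atTop (𝓝 (h j))) :
    Tendsto (fun n => betaInf β (H n)) atTop (𝓝 (betaInf β h)) := by
  have hc := continuousOn_betaInf hss hθ0 hθ1 hcont h hh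
  have h1 : Tendsto H atTop (𝓝[{u | SeqBox γ u}] h) :=
    tendsto_nhdsWithin_iff.mpr ⟨tendsto_pi_nhds.mpr hconv, Eventually.of_forall hH⟩
  exact hc.tendsto.comp h1

/-- The same with node U2's `HistLipschitz Λ γ β` (ANY `Λ`, no sign, no row bound, no fading) as the source of continuity
(`T4BetaStationary.betaContH_of_histLipschitz`). [folklore] -/
theorem tendsto_betaInf_of_agewise_of_histLipschitz {Λ : ℕ → ℕ → ℝ} (hss : ScaleShiftRate c θ γ β) (hθ0 : 0 ≤ θ)
    (hθ1 : θ < 1) (hL : HistLipschitz Λ γ β) {H : ℕ → ℕ → ℝ} {h : ℕ → ℝ} (hH : ∀ n, SeqBox γ (H n)) (hh : SeqBox γ h)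
    (hconv : ∀ j, Tendsto (fun n => H n j) atTop (𝓝 (h j))) :
    Tendsto (fun n => betaInf β (H n)) atTop (𝓝 (betaInf β h)) :=
  tendsto_betaInf_of_agewise hss hθ0 hθ1 (betaContH_of_histLipschitz hL) hH hh hconv

/-! ## §2 The lattice side: the identification from scale-wise convergence of the recursion variables alone -/

variable {g : ℕ → ℕ → ℝ} {gIR : ℝ}

/-- `1∕γ² ≤ astar g m` whenever the recursion variables of runs in the box converge to it. [folklore] -/
theorem inv_sq_gamma_le_astar_of_tendsto (hbox : ∀ K i, i ≤ K → 0 < g K i ∧ g K i ≤ γ) {m : ℕ}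
    (hconv : Tendsto (invSq g m) atTop (𝓝 (astar g m))) : 1 / γ ^ 2 ≤ astar g m :=
  ge_of_tendsto' hconv fun n => inv_sq_gamma_le_invSq hbox m n

/-- … hence `0 < astar g m`. [folklore] -/
theorem astar_pos_of_tendsto (hbox : ∀ K i, i ≤ K → 0 < g K i ∧ g K i ≤ γ) {m : ℕ}
    (hconv : Tendsto (invSq g m) atTop (𝓝 (astar g m))) : 0 < astar g m := by
  have hγ : 0 < γ := (hbox 0 0 le_rfl).1.trans_le (hbox 0 0 le_rfl).2
  exact lt_of_lt_of_le (by positivity) (inv_sq_gamma_le_astar_of_tendsto hbox hconv)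

/-- The continuum running coupling `gstar g m = 1∕√(astar g m)` is positive. [folklore] -/
theorem gstar_pos_of_tendsto (hbox : ∀ K i, i ≤ K → 0 < g K i ∧ g K i ≤ γ) {m : ℕ}
    (hconv : Tendsto (invSq g m) atTop (𝓝 (astar g m))) : 0 < gstar g m :=
  one_div_pos.mpr (Real.sqrt_pos.mpr (astar_pos_of_tendsto hbox hconv))

/-- … and at most `γ`. [folklore] -/
theorem gstar_le_of_tendsto (hbox : ∀ K i, i ≤ K → 0 < g K i ∧ g K i ≤ γ) {m : ℕ}
    (hconv : Tendsto (invSq g m) atTop (𝓝 (astar g m))) : gstar g m ≤ γ :=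
  one_div_sqrt_le ((hbox 0 0 le_rfl).1.trans_le (hbox 0 0 le_rfl).2) (inv_sq_gamma_le_astar_of_tendsto hbox hconv)

/-- `1∕(gstar g m)² = astar g m`. [folklore] -/
theorem one_div_gstar_sq_of_tendsto (hbox : ∀ K i, i ≤ K → 0 < g K i ∧ g K i ≤ γ) {m : ℕ}
    (hconv : Tendsto (invSq g m) atTop (𝓝 (astar g m))) : 1 / (gstar g m) ^ 2 = astar g m :=
  one_div_sq_one_div_sqrt (astar_pos_of_tendsto hbox hconv)

/-- **THE EFFECTIVE COUPLINGS CONVERGE** at physical scale `m`: `g (n+m) n → gstar g m` (continuity of `1∕√·` at the positive limit;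
node U2's `tendsto_coupling` with its `InjectedRate` source replaced by the convergence itself). [folklore] -/
theorem tendsto_coupling_of_tendsto (hbox : ∀ K i, i ≤ K → 0 < g K i ∧ g K i ≤ γ) {m : ℕ}
    (hconv : Tendsto (invSq g m) atTop (𝓝 (astar g m))) : Tendsto (fun n => g (n + m) n) atTop (𝓝 (gstar g m)) := by
  have ha := astar_pos_of_tendsto hbox hconv
  have h2 : Tendsto (fun n => 1 / Real.sqrt (invSq g m n)) atTop (𝓝 (1 / Real.sqrt (astar g m))) :=
    tendsto_const_nhds.div hconv.sqrt (Real.sqrt_pos.mpr ha).ne'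
  unfold gstar
  exact h2.congr fun n => one_div_sqrt_invSq hbox m n

/-- At the infrared end the recursion variable is pinned: `astar g 0 = 1∕g_IR²`. [folklore] -/
theorem astar_zero_of_tendsto (hpin : ∀ K, g K K = gIR) (hconv : Tendsto (invSq g 0) atTop (𝓝 (astar g 0))) :
    astar g 0 = 1 / gIR ^ 2 :=
  tendsto_nhds_unique hconv (tendsto_const_nhds.congr fun n => (invSq_zero hpin n).symm)

/-- … so `gstar g 0 = g_IR`. [folklore] -/
theorem gstar_zero_of_tendsto (hpin : ∀ K, g K K = gIR) (hgIR : 0 < gIR)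
    (hconv : Tendsto (invSq g 0) atTop (𝓝 (astar g 0))) : gstar g 0 = gIR := by
  unfold gstar
  rw [astar_zero_of_tendsto hpin hconv]
  exact one_div_sqrt_one_div_sq hgIR

/-- The continuum running coupling is a box-valued history. [folklore] -/
theorem seqBox_gstar_of_tendsto (hbox : ∀ K i, i ≤ K → 0 < g K i ∧ g K i ≤ γ)
    (hconv : ∀ m, Tendsto (invSq g m) atTop (𝓝 (astar g m))) : SeqBox γ (gstar g) :=
  fun m => ⟨gstar_pos_of_tendsto hbox (hconv m), gstar_le_of_tendsto hbox (hconv m)⟩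

/-- The limit history above physical scale `m` is box-valued. [folklore] -/
theorem limHist_seqBox_of_tendsto (hbox : ∀ K i, i ≤ K → 0 < g K i ∧ g K i ≤ γ)
    (hconv : ∀ m, Tendsto (invSq g m) atTop (𝓝 (astar g m))) (m : ℕ) : SeqBox γ (limHist g m) :=
  fun j => ⟨gstar_pos_of_tendsto hbox (hconv (m + 1 + j)), gstar_le_of_tendsto hbox (hconv (m + 1 + j))⟩

/-- AGEWISE CONVERGENCE OF THE HISTORIES: `histAbove g m n j → limHist g m j` for each age `j` (node U2's `tendsto_histAbove`, source
replaced). [folklore] -/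
theorem tendsto_histAbove_of_tendsto (hbox : ∀ K i, i ≤ K → 0 < g K i ∧ g K i ≤ γ)
    (hconv : ∀ m, Tendsto (invSq g m) atTop (𝓝 (astar g m))) (m j : ℕ) :
    Tendsto (fun n => histAbove g m n j) atTop (𝓝 (limHist g m j)) := by
  have h1 := (tendsto_coupling_of_tendsto hbox (hconv (m + 1 + j))).comp (tendsto_sub_atTop_nat j)
  refine h1.congr' ?_
  filter_upwards [eventually_ge_atTop j] with n hn
  show g (n - j + (m + 1 + j)) (n - j) = g (n + m + 1) (n - j)
  congr 1
  omega

/-- **THE TANNERY STEP WITHOUT A MEMORY PROFILE**: `betaInf β (histAbove g m n) → betaInf β (limHist g m)` — node U2's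
`tendsto_betaInf_histAbove` with `HistLipschitz` ∧ `FadingMemory` replaced by `BetaContH γ β` and `InjectedRate` by the convergence of the
recursion variables. [folklore] -/
theorem tendsto_betaInf_histAbove_of_tendsto {θs : ℝ} (hbox : ∀ K i, i ≤ K → 0 < g K i ∧ g K i ≤ γ)
    (hconv : ∀ m, Tendsto (invSq g m) atTop (𝓝 (astar g m))) (hss : ScaleShiftRate c θs γ β) (hθs0 : 0 ≤ θs)
    (hθs1 : θs < 1) (hcont : BetaContH γ β) (m : ℕ) :
    Tendsto (fun n => betaInf β (histAbove g m n)) atTop (𝓝 (betaInf β (limHist g m))) :=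
  tendsto_betaInf_of_agewise hss hθs0 hθs1 hcont (fun n => histAbove_seqBox hbox m n)
    (limHist_seqBox_of_tendsto hbox hconv m) (tendsto_histAbove_of_tendsto hbox hconv m)

/-- **THE DIAGONAL β-VALUES CONVERGE TO THE LIMIT FUNCTIONAL AT THE LIMIT HISTORY**, no memory hypothesis:
`β n (prefixOf (g (n+m+1)) n) → betaInf β (limHist g m)` (representation tail `cθs^n∕(1−θs)` + the Tannery step above). [folklore] -/
theorem tendsto_beta_diag_betaInf_of_tendsto {θs : ℝ} (hbox : ∀ K i, i ≤ K → 0 < g K i ∧ g K i ≤ γ)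
    (hconv : ∀ m, Tendsto (invSq g m) atTop (𝓝 (astar g m))) (hss : ScaleShiftRate c θs γ β) (hθs0 : 0 ≤ θs)
    (hθs1 : θs < 1) (hcont : BetaContH γ β) (m : ℕ) :
    Tendsto (fun n => β n (prefixOf (g (n + m + 1)) n)) atTop (𝓝 (betaInf β (limHist g m))) := by
  have h1 : Tendsto (fun n => β n (revHist (histAbove g m n) n) - betaInf β (histAbove g m n)) atTop (𝓝 0) := by
    have hr : Tendsto (fun n => c * θs ^ n / (1 - θs)) atTop (𝓝 (c * 0 / (1 - θs))) :=
      ((tendsto_pow_atTop_nhds_zero_of_lt_one hθs0 hθs1).const_mul c).div_const (1 - θs)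
    rw [mul_zero, zero_div] at hr
    refine squeeze_zero_norm (fun n => ?_) hr
    rw [Real.norm_eq_abs]
    exact abs_beta_revHist_sub_betaInf_le hss hθs1 (histAbove_seqBox hbox m n) n
  have h2 := tendsto_betaInf_histAbove_of_tendsto hbox hconv hss hθs0 hθs1 hcont m
  have h3 := h1.add h2
  rw [zero_add] at h3
  refine h3.congr fun n => ?_
  rw [sub_add_cancel, revHist_histAbove]

/-- The diagonal β-values converge to `bstar g m = astar g (m+1) − astar g m` ((0.20) along the runs, `invSq_flow`). [folklore] -/
theorem tendsto_beta_diag_of_tendsto (hrun : ∀ K, RGEqH K β (g K))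
    (hconv : ∀ m, Tendsto (invSq g m) atTop (𝓝 (astar g m))) (m : ℕ) :
    Tendsto (fun n => β n (prefixOf (g (n + m + 1)) n)) atTop (𝓝 (bstar g m)) := by
  unfold bstar
  have h1 := hconv (m + 1)
  have h2 := (hconv m).comp (tendsto_add_atTop_nat 1)
  refine (h1.sub h2).congr fun n => ?_
  show invSq g (m + 1) n - invSq g m (n + 1) = β n (prefixOf (g (n + m + 1)) n)
  rw [invSq_flow hrun m n]; ring

/-- **IDENTIFICATION WITHOUT A MEMORY HYPOTHESIS**: `bstar g m = betaInf β (limHist g m)` — P2's continuum β-value at physical scale `m`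
IS the limit functional at the limit trajectory's history above that scale, for ANY family of runs in the box whose recursion variables
converge scale-wise, under `ScaleShiftRate` + `BetaContH` only. [folklore] -/
theorem bstar_eq_betaInf_of_tendsto {θs : ℝ} (hbox : ∀ K i, i ≤ K → 0 < g K i ∧ g K i ≤ γ)
    (hrun : ∀ K, RGEqH K β (g K)) (hconv : ∀ m, Tendsto (invSq g m) atTop (𝓝 (astar g m)))
    (hss : ScaleShiftRate c θs γ β) (hθs0 : 0 ≤ θs) (hθs1 : θs < 1) (hcont : BetaContH γ β) (m : ℕ) :
    bstar g m = betaInf β (limHist g m) :=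
  tendsto_nhds_unique (tendsto_beta_diag_of_tendsto hrun hconv m)
    (tendsto_beta_diag_betaInf_of_tendsto hbox hconv hss hθs0 hθs1 hcont m)

/-- P2's limit flow in the coupling: `1∕(gstar g (m+1))² = 1∕(gstar g m)² + bstar g m`. [folklore] -/
theorem gstar_flow_of_tendsto (hbox : ∀ K i, i ≤ K → 0 < g K i ∧ g K i ≤ γ)
    (hconv : ∀ m, Tendsto (invSq g m) atTop (𝓝 (astar g m))) (m : ℕ) :
    1 / (gstar g (m + 1)) ^ 2 = 1 / (gstar g m) ^ 2 + bstar g m := by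
  rw [one_div_gstar_sq_of_tendsto hbox (hconv _), one_div_gstar_sq_of_tendsto hbox (hconv _), astar_succ]

/-- **THE AUTONOMOUS LIMIT FLOW WITHOUT A MEMORY HYPOTHESIS**:
`1∕(gstar g (m+1))² = 1∕(gstar g m)² + betaInf β (fun j ↦ gstar g (m+1+j))`. [folklore] -/
theorem gstar_flow_autonomous_of_tendsto {θs : ℝ} (hbox : ∀ K i, i ≤ K → 0 < g K i ∧ g K i ≤ γ)
    (hrun : ∀ K, RGEqH K β (g K)) (hconv : ∀ m, Tendsto (invSq g m) atTop (𝓝 (astar g m)))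
    (hss : ScaleShiftRate c θs γ β) (hθs0 : 0 ≤ θs) (hθs1 : θs < 1) (hcont : BetaContH γ β) (m : ℕ) :
    1 / (gstar g (m + 1)) ^ 2 = 1 / (gstar g m) ^ 2 + betaInf β (fun j => gstar g (m + 1 + j)) := by
  rw [gstar_flow_of_tendsto hbox hconv m, bstar_eq_betaInf_of_tendsto hbox hrun hconv hss hθs0 hθs1 hcont m]
  rfl

/-- **THE CONTINUUM RUNNING COUPLING SOLVES THE FLOW WITH MEMORY** generated by `betaInf β` from the pin `g_IR`:
`MemFlow (betaInf β) gIR (gstar g)` (`T4BetaFlowWellPosed.MemFlow`), no memory hypothesis. [folklore] -/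
theorem memFlow_gstar_of_tendsto {θs : ℝ} (hbox : ∀ K i, i ≤ K → 0 < g K i ∧ g K i ≤ γ)
    (hrun : ∀ K, RGEqH K β (g K)) (hpin : ∀ K, g K K = gIR) (hconv : ∀ m, Tendsto (invSq g m) atTop (𝓝 (astar g m)))
    (hss : ScaleShiftRate c θs γ β) (hθs0 : 0 ≤ θs) (hθs1 : θs < 1) (hcont : BetaContH γ β) :
    MemFlow (betaInf β) gIR (gstar g) := by
  have hgIR : 0 < gIR := by rw [← hpin 0]; exact (hbox 0 0 le_rfl).1
  exact ⟨gstar_zero_of_tendsto hpin hgIR (hconv 0),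
    fun m => gstar_flow_autonomous_of_tendsto hbox hrun hconv hss hθs0 hθs1 hcont m⟩

/-! ## §3 Ends: node U2's class with `FadingMemory` deleted; (E33)'s rows-only classes -/

/-- **NODE U2's `gstar_flow_autonomous` WITH `FadingMemory` DELETED.**  Binder list of `T4BetaStationary.gstar_flow_autonomous`: node U2's
output shape `InjectedRate C 0 θ₁` (`θ₁ < 1`), runs in the box, `RGEqH`, `ScaleShiftRate c θs γ β` (`0 ≤ θs < 1`), `HistLipschitz Λ γ β`,
`FadingMemory Cm θs Λ`.  HERE: the same conclusion with `FadingMemory Cm θs Λ` REMOVED and `HistLipschitz Λ γ β` kept for ANY `Λ` (it is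
used only as continuity). [folklore] -/
theorem gstar_flow_autonomous_of_injectedRate {C θ₁ θs : ℝ} {Λ : ℕ → ℕ → ℝ} (hθ1 : θ₁ < 1)
    (hinj : InjectedRate C 0 θ₁ (fun K j => disc (g K) (g (K + 1)) j))
    (hbox : ∀ K i, i ≤ K → 0 < g K i ∧ g K i ≤ γ) (hrun : ∀ K, RGEqH K β (g K))
    (hss : ScaleShiftRate c θs γ β) (hL : HistLipschitz Λ γ β) (hθs0 : 0 ≤ θs) (hθs1 : θs < 1) (m : ℕ) :
    1 / (gstar g (m + 1)) ^ 2 = 1 / (gstar g m) ^ 2 + betaInf β (fun j => gstar g (m + 1 + j)) :=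
  gstar_flow_autonomous_of_tendsto hbox hrun (fun m => tendsto_invSq hθ1 hinj m) hss hθs0 hθs1
    (betaContH_of_histLipschitz hL) m

/-- Node U2's `bstar_eq_betaInf` with `FadingMemory` deleted (any `Λ`). [folklore] -/
theorem bstar_eq_betaInf_of_injectedRate {C θ₁ θs : ℝ} {Λ : ℕ → ℕ → ℝ} (hθ1 : θ₁ < 1)
    (hinj : InjectedRate C 0 θ₁ (fun K j => disc (g K) (g (K + 1)) j))
    (hbox : ∀ K i, i ≤ K → 0 < g K i ∧ g K i ≤ γ) (hrun : ∀ K, RGEqH K β (g K))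
    (hss : ScaleShiftRate c θs γ β) (hL : HistLipschitz Λ γ β) (hθs0 : 0 ≤ θs) (hθs1 : θs < 1) (m : ℕ) :
    bstar g m = betaInf β (limHist g m) :=
  bstar_eq_betaInf_of_tendsto hbox hrun (fun m => tendsto_invSq hθ1 hinj m) hss hθs0 hθs1 (betaContH_of_histLipschitz hL) m

/-- Node U2's `T4BetaFlowWellPosed.memFlow_gstar` with `FadingMemory` deleted (any `Λ`). [folklore] -/
theorem memFlow_gstar_of_injectedRate {C θ₁ θs : ℝ} {Λ : ℕ → ℕ → ℝ} (hθ1 : θ₁ < 1)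
    (hinj : InjectedRate C 0 θ₁ (fun K j => disc (g K) (g (K + 1)) j))
    (hbox : ∀ K i, i ≤ K → 0 < g K i ∧ g K i ≤ γ) (hrun : ∀ K, RGEqH K β (g K)) (hpin : ∀ K, g K K = gIR)
    (hss : ScaleShiftRate c θs γ β) (hL : HistLipschitz Λ γ β) (hθs0 : 0 ≤ θs) (hθs1 : θs < 1) :
    MemFlow (betaInf β) gIR (gstar g) :=
  memFlow_gstar_of_tendsto hbox hrun hpin (fun m => tendsto_invSq hθ1 hinj m) hss hθs0 hθs1 (betaContH_of_histLipschitz hL)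

/-- **THE AUTONOMOUS LIMIT FLOW WITHOUT FADING MEMORY — (E33)'s SIGN CLASS.**  A family of runs `K ↦ g K` of (0.20) in ]0,γ], all pinned at
`g K K = g_IR`, with ONE history family `β` under: `ScaleShiftRate c θ γ β` (`c ≥ 0`, `0 ≤ θ < 1`); `HistLipschitz Λ γ β`, `Λ ≥ 0`, with
ONLY the k-uniform ROW total weight `Σ_{i≤k} Λ k i ≤ M`; the sign `BetaLowerH 0 γ β`; the eventual floor `EventualLowerH b γ k₀ β` (`b > 0`);
SMALLNESS `M·((k₀+1)γ³ + 2γ∕b) < 1`.  THEN the continuum running coupling (which exists by (E33d) `continuum_of_sign`) is box-valued, solves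
`MemFlow (betaInf β) g_IR`, and `bstar g m = betaInf β (limHist g m)` at every scale.  Binders NOT PRINTED, never facts.
[cite: Balaban1987RG1, (0.20) p.256 and (0.31) p.259] -/
theorem memFlow_gstar_of_sign {b M : ℝ} {k₀ : ℕ} {Λ : ℕ → ℕ → ℝ}
    (hγ : 0 < γ) (hb : 0 < b) (hc : 0 ≤ c) (hθ0 : 0 ≤ θ) (hθ1 : θ < 1)
    (hrun : ∀ K, RGEqH K β (g K)) (hbox : ∀ K i, i ≤ K → 0 < g K i ∧ g K i ≤ γ) (hpin : ∀ K, g K K = gIR)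
    (hS : ScaleShiftRate c θ γ β) (hL : HistLipschitz Λ γ β) (hΛ : ∀ k i, i ≤ k → 0 ≤ Λ k i) (hM : 0 ≤ M)
    (hrow : ∀ k, ∑ i ∈ range (k + 1), Λ k i ≤ M)
    (hsign : BetaLowerH 0 γ β) (hlo : EventualLowerH b γ k₀ β)
    (hsmall : M * (((k₀ : ℝ) + 1) * γ ^ 3 + 2 * γ / b) < 1) :
    SeqBox γ (gstar g) ∧ MemFlow (betaInf β) gIR (gstar g) ∧ ∀ m, bstar g m = betaInf β (limHist g m) := by
  have hconv : ∀ m, Tendsto (invSq g m) atTop (𝓝 (astar g m)) := fun m =>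
    (continuum_of_sign hγ hb hc hθ0 hθ1 hrun hbox hpin hS hL hΛ hM hrow hsign hlo hsmall m).2
  exact ⟨seqBox_gstar_of_tendsto hbox hconv,
    memFlow_gstar_of_tendsto hbox hrun hpin hconv hS hθ0 hθ1 (betaContH_of_histLipschitz hL),
    fun m => bstar_eq_betaInf_of_tendsto hbox hrun hconv hS hθ0 hθ1 (betaContH_of_histLipschitz hL) m⟩

/-- **THE AUTONOMOUS LIMIT FLOW WITHOUT FADING MEMORY — (E33)'s EVENTUAL CLASS** (no sign): `ScaleShiftRate c θ γ β`, `HistLipschitz Λ γ β`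
with rows `≤ M`, the eventual floor `EventualLowerH b γ k₀ β` (`b > 0`), `β ≥ −β′` on the boxes, `k₀β′γ² ≤ 1∕2`, SMALLNESS
`2√2·M·((k₀+1)γ³ + 2γ∕b) < 1` ⟹ the same three conclusions ((E33d) `continuum_of_eventual` BY NAME + §2).
[cite: Balaban1987RG1, (0.20) p.256 and §1 p.264] -/
theorem memFlow_gstar_of_eventual {b β' M : ℝ} {k₀ : ℕ} {Λ : ℕ → ℕ → ℝ}
    (hγ : 0 < γ) (hb : 0 < b) (hc : 0 ≤ c) (hθ0 : 0 ≤ θ) (hθ1 : θ < 1)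
    (hrun : ∀ K, RGEqH K β (g K)) (hbox : ∀ K i, i ≤ K → 0 < g K i ∧ g K i ≤ γ) (hpin : ∀ K, g K K = gIR)
    (hS : ScaleShiftRate c θ γ β) (hL : HistLipschitz Λ γ β) (hΛ : ∀ k i, i ≤ k → 0 ≤ Λ k i) (hM : 0 ≤ M)
    (hrow : ∀ k, ∑ i ∈ range (k + 1), Λ k i ≤ M)
    (hlo : EventualLowerH b γ k₀ β) (hβ' : 0 ≤ β') (hlow : ∀ k v, v ∈ Box γ k → -β' ≤ β k v)
    (hk₀ : (k₀ : ℝ) * β' * γ ^ 2 ≤ 1 / 2)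
    (hsmall : 2 * Real.sqrt 2 * M * (((k₀ : ℝ) + 1) * γ ^ 3 + 2 * γ / b) < 1) :
    SeqBox γ (gstar g) ∧ MemFlow (betaInf β) gIR (gstar g) ∧ ∀ m, bstar g m = betaInf β (limHist g m) := by
  have hconv : ∀ m, Tendsto (invSq g m) atTop (𝓝 (astar g m)) := fun m =>
    (continuum_of_eventual hγ hb hc hθ0 hθ1 hrun hbox hpin hS hL hΛ hM hrow hlo hβ' hlow hk₀ hsmall m).2.1
  exact ⟨seqBox_gstar_of_tendsto hbox hconv,
    memFlow_gstar_of_tendsto hbox hrun hpin hconv hS hθ0 hθ1 (betaContH_of_histLipschitz hL),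
    fun m => bstar_eq_betaInf_of_tendsto hbox hrun hconv hS hθ0 hθ1 (betaContH_of_histLipschitz hL) m⟩

end Summit.QuantumFields.BalabanUV.Beta.EriceRemainderEnclosureHistoryAutonomy

end
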